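import Summits.QuantumFields.YangMills.Theorems.BalabanUVNodesN21ExpChartSharpRadiusHaar

/-!
# N21 (NE7c) · THE SHARP RADIUS `√2·π` OF THE `SU(N)` EXPONENTIAL CHART, III (A2): ON THE SPHERE `‖v‖_HS = √2·π` ALL THREE INPUTS
# FAIL AT ONE POINT — the chart point with angles `(π, −π, 0, …, 0)` has a SINGULAR differential (`det T_v = 0`), its exponential is file
# 18's properness witness `diag(−1, −1, 1, …, 1)` (so the witness ENTERS the window exactly at `√2·π`), and (file 19 A2) it shares that
# exponential with its antipode

Width seat pub-ymgap-dag-n21-w1 (g4; director-ym №197 ∕ HUMAN RULING D-0149), node N21 = NE7c (NOT PRINTED in [Bałaban 1983–89], NOT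
proved), lane K3⁸ `SpineGivenEndpointR13SepCoPHV` (stmt-QuantumFields-27366, KEY MAP v2; lineage K3⁷ stmt-QuantumFields-20544),
`--kind proof --supports … --as helper`.  File 25 of the seat's chain — the A2 ∕ boundary companion of files 23–24, which prove injectivity,
`0 < det T_v`, (CH)₁, the realized engine and properness on every window `S < √2·π`; this file certifies that NONE of them survives to the
closed `√2·π`-ball for `N ≥ 2` (file 24 §10: at `N = 2` the closed ball is the whole group).  THEOREMS ONLY: 0 `def`, 0 `sorry`; count-neutral.
Imports file 24 (hence files 23, 19, 18 and pub-balaban's chart ∕ Duhamel modules).  NO Theses import.  Restates nothing; cites by name.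

WHAT IS PROVED ([folklore]).
* §1 `exists_chartPt_pi_neg_pi` — for `N ≥ 2` a chart point `v₀` with `H(v₀) = diag(π, −π, 0, …, 0)` (frame `1`) and `‖v₀‖ = √2·π`
  (file 19's `exists_herm_eq_conjDiag`).
* §2 ★ `det_duhT_eq_zero_of_herm_eq` — at such a point `det T_{v₀} = ∏_{i<j} sinc²((θ_j − θ_i)/2) = 0` (the gap `θ_1 − θ_0 = −2π`, `sinc(−π) = 0`;
  pub-balaban's `det_eq_prod_sinc`); ★ `exists_norm_eq_sqrt_two_mul_pi_det_duhT_eq_zero`; `not_injective_duhT`, ★ `exists_norm_eq_not_injective_fderiv_expM`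
  (the differential of the ambient chart is NOT injective somewhere on the sphere — contrast file 23's `injective_fderiv_expM_of_norm_lt`).
* §3 ★ `exists_mem_expBallSU_sqrt_two_mul_pi_forall_lt_not_mem` — for `N ≥ 2` some `U ∈ SU(N)` (namely `diag(−1, −1, 1, …)`) lies in the
  CLOSED `√2·π`-window and in NO window of radius `S < √2·π`: file 24's properness range `S < √2·π` is where the witness works, exactly.

HONEST FRAMING.  [folklore] linear algebra over pub-balaban's modules BY NAME; no located letter of any N21 road is touched; types nothing of Bałaban's;
(M1) ∕ NE7c NOT PRINTED ∕ NOT proved; **N21 NOT discharged**; K3⁸ NOT claimed; counts unmoved (typed 28∕28 · discharged 5∕27); never a count claim; one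
finite 𝕋⁴ at fixed ε — R4 would close only the conditional finite-𝕋⁴ rung `BalabanLadder.UV`, NOT the Yang–Mills mass gap (Clay); nothing about ℝ⁴ ∕ OS.
No decl below carries a cite tag.
-/

set_option autoImplicit false

noncomputable section

open scoped BigOperators ENNReal
open MeasureTheory Set Function Metric Matrix Finset
open Complex (I)

namespace Summit.QuantumFields.YangMills.Theorems.N21ExpChartSharpRadiusBoundary

open Literature.MathematicalPhysics.QuantumFieldTheory.Balaban1983to89
open Summit.QuantumFields.BalabanUV.T4Continuum
open Summit.QuantumFields.BalabanUV.T4Continuum.ShellMeasureExpChartSUN (SUN ChartSU genSU expPtSU coe_expPtSU)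
open Summit.QuantumFields.BalabanUV.T4Continuum.ShellMeasureVandermondeSUN (conjDiag)
open Summit.QuantumFields.BalabanUV.T4Continuum.ShellMeasureExpJacobianSUN (herm exp_genSU_eq_conjDiag norm_sq_eq_sum_sq)
open Summit.QuantumFields.BalabanUV.T4Continuum.ShellMeasureExpDuhamelSUN (duhT genSU_duhT_eq_integral)
open Summit.QuantumFields.BalabanUV.T4Continuum.ShellMeasureExpDuhamelDetSUN (det_eq_prod_sinc)
open Summit.QuantumFields.BalabanUV.T4Continuum.ShellMeasureHaarHausdorffSUN (expM)
open Summit.QuantumFields.BalabanUV.T4Continuum.ShellMeasureExpHaarAreaSUN (DexpM fderiv_expM)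
open Summit.QuantumFields.BalabanUV.T4Continuum.ShellMeasureScalingSUN (expBallSU)
open Summit.QuantumFields.YangMills.Theorems.N21ExpChartSurjective (exists_herm_eq_conjDiag)
open Summit.QuantumFields.YangMills.Theorems.N21ExpChartSharpRadiusHaar (conjDiag_one_left exists_not_mem_expBallSU_of_lt)

variable {N : ℕ}

/-! ## §1 The boundary point with angles `(π, −π, 0, …, 0)` -/

section Point

/-- **THE BOUNDARY CHART POINT**: for `N ≥ 2` there is `v₀` with `H(v₀) = diag(π, −π, 0, …, 0)` (unit frame) and `‖v₀‖_HS = √2·π`; its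
exponential is `diag(−1, −1, 1, …, 1)`.  (Inline angles, no `def`.) [folklore] -/
theorem exists_chartPt_pi_neg_pi (hN : 2 ≤ N) :
    ∃ (v : ChartSU N) (θ : Fin N → ℝ), herm v = conjDiag 1 (fun k => (θ k : ℂ)) ∧ ‖v‖ = Real.sqrt 2 * Real.pi ∧
      θ ⟨0, by omega⟩ = Real.pi ∧ θ ⟨1, by omega⟩ = -Real.pi ∧
      (∀ k, k ≠ ⟨0, by omega⟩ → k ≠ ⟨1, by omega⟩ → θ k = 0) := by
  let i₀ : Fin N := ⟨0, by omega⟩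
  let i₁ : Fin N := ⟨1, by omega⟩
  have hne : i₀ ≠ i₁ := fun h => by
    have := congrArg Fin.val h
    simp [i₀, i₁] at this
  let θ : Fin N → ℝ := fun k => if k = i₀ then Real.pi else if k = i₁ then -Real.pi else 0
  have hθ₀ : θ i₀ = Real.pi := if_pos rfl
  have hθ₁ : θ i₁ = -Real.pi := by
    show (if i₁ = i₀ then Real.pi else if i₁ = i₁ then -Real.pi else 0) = -Real.pi
    rw [if_neg hne.symm, if_pos rfl]
  have hθk : ∀ k, k ≠ i₀ → k ≠ i₁ → θ k = 0 := fun k h0 h1 => by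
    show (if k = i₀ then Real.pi else if k = i₁ then -Real.pi else 0) = 0
    rw [if_neg h0, if_neg h1]
  -- the sum over `univ` splits off `i₀` and `i₁`; the rest vanishes
  have hsplit : ∀ f : Fin N → ℝ, (∀ k, k ≠ i₀ → k ≠ i₁ → f k = 0) → ∑ k, f k = f i₀ + f i₁ := by
    intro f hf
    rw [← Finset.add_sum_erase _ _ (Finset.mem_univ i₀),
      ← Finset.add_sum_erase _ _ (Finset.mem_erase.mpr ⟨hne.symm, Finset.mem_univ i₁⟩),
      Finset.sum_eq_zero (fun k hk => ?_), add_zero]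
    obtain ⟨hk1, hk⟩ := Finset.mem_erase.mp hk
    obtain ⟨hk0, _⟩ := Finset.mem_erase.mp hk
    exact hf k hk0 hk1
  have hsum : ∑ k, θ k = 0 := by rw [hsplit θ hθk, hθ₀, hθ₁, add_neg_cancel]
  obtain ⟨v, hv⟩ := exists_herm_eq_conjDiag 1 θ hsum
  refine ⟨v, θ, hv, ?_, hθ₀, hθ₁, hθk⟩
  have hsq : ‖v‖ ^ 2 = 2 * Real.pi ^ 2 := by
    rw [norm_sq_eq_sum_sq hv, hsplit (fun k => θ k ^ 2) (fun k h0 h1 => by rw [hθk k h0 h1]; ring), hθ₀, hθ₁]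
    ring
  have h0 : 0 ≤ Real.sqrt 2 * Real.pi := by positivity
  refine le_antisymm ?_ ?_
  · refine (pow_le_pow_iff_left₀ (norm_nonneg v) h0 two_ne_zero).mp ?_
    rw [hsq, mul_pow, Real.sq_sqrt zero_le_two]
  · refine (pow_le_pow_iff_left₀ h0 (norm_nonneg v) two_ne_zero).mp ?_
    rw [hsq, mul_pow, Real.sq_sqrt zero_le_two]

end Point

/-! ## §2 The differential is singular there -/

section Singular

/-- `sinc (−π) = 0`. [folklore] -/
theorem sinc_neg_pi : Real.sinc (-Real.pi) = 0 := by
  rw [Real.sinc_neg, Real.sinc_of_ne_zero Real.pi_ne_zero, Real.sin_pi, zero_div]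

/-- ★ **`det T_v = 0` AT A CHART POINT WITH TWO ANGLES `π`, `−π`** (any frame): pub-balaban's `det_eq_prod_sinc` has the factor
`sinc²((θ_1 − θ_0)/2) = sinc²(−π) = 0`. [folklore] -/
theorem det_duhT_eq_zero_of_herm_eq {v : ChartSU N} {U : Matrix.unitaryGroup (Fin N) ℂ} {θ : Fin N → ℝ}
    (h : herm v = conjDiag U fun k => (θ k : ℂ)) {i₀ i₁ : Fin N} (hlt : i₀ < i₁) (h₀ : θ i₀ = Real.pi) (h₁ : θ i₁ = -Real.pi) :
    LinearMap.det (duhT v : ChartSU N →ₗ[ℝ] ChartSU N) = 0 := by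
  rw [det_eq_prod_sinc h _ (genSU_duhT_eq_integral v)]
  refine Finset.prod_eq_zero (Finset.mem_univ i₀) (Finset.prod_eq_zero (Finset.mem_Ioi.mpr hlt) ?_)
  rw [h₀, h₁, show (-Real.pi - Real.pi) / 2 = -Real.pi by ring, sinc_neg_pi, zero_pow two_ne_zero]

/-- ★ **ON THE SPHERE `‖v‖_HS = √2·π` THE DIFFERENTIAL OF THE CHART IS SINGULAR SOMEWHERE** (`N ≥ 2`): file 23's
`det_duhT_pos_of_norm_lt` (`‖v‖ < √2·π ⇒ 0 < det T_v`) does not reach the boundary. [folklore] -/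
theorem exists_norm_eq_sqrt_two_mul_pi_det_duhT_eq_zero (hN : 2 ≤ N) :
    ∃ v : ChartSU N, ‖v‖ = Real.sqrt 2 * Real.pi ∧ LinearMap.det (duhT v : ChartSU N →ₗ[ℝ] ChartSU N) = 0 := by
  obtain ⟨v, θ, hv, hnorm, h₀, h₁, -⟩ := exists_chartPt_pi_neg_pi hN
  exact ⟨v, hnorm, det_duhT_eq_zero_of_herm_eq hv (Fin.mk_lt_mk.mpr Nat.zero_lt_one) h₀ h₁⟩

/-- a chart operator with zero determinant is not one-to-one. [folklore] -/
theorem not_injective_duhT {v : ChartSU N} (hdet : LinearMap.det (duhT v : ChartSU N →ₗ[ℝ] ChartSU N) = 0) :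
    ¬ Injective (duhT v) := by
  have hker : LinearMap.ker (duhT v : ChartSU N →ₗ[ℝ] ChartSU N) ≠ ⊥ := LinearMap.det_eq_zero_iff_ker_ne_bot.mp hdet
  intro hinj
  apply hker
  exact LinearMap.ker_eq_bot.mpr hinj

/-- ★ **THE DIFFERENTIAL OF THE AMBIENT CHART `expM` IS NOT INJECTIVE SOMEWHERE ON THE SPHERE `‖v‖ = √2·π`** (`N ≥ 2`) — the area
formula's hypothesis fails on the closed `√2·π`-ball. [folklore] -/
theorem exists_norm_eq_not_injective_fderiv_expM (hN : 2 ≤ N) :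
    ∃ v : ChartSU N, ‖v‖ = Real.sqrt 2 * Real.pi ∧ ¬ Injective (fderiv ℝ (expM (N := N)) v) := by
  obtain ⟨v, hnorm, hdet⟩ := exists_norm_eq_sqrt_two_mul_pi_det_duhT_eq_zero hN
  have key : ∀ h, DexpM v h = NormedSpace.exp (genSU v) * ShellMeasureExpDuhamelSUN.genSUL (duhT v h) := fun _ => rfl
  refine ⟨v, hnorm, fun hinj => not_injective_duhT hdet fun h₁ h₂ h12 => hinj ?_⟩
  rw [fderiv_expM, key, key, h12]

end Singular

/-! ## §3 File 18's properness witness enters the window exactly at `√2·π` -/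

section Witness

/-- ★ **SOME `U ∈ SU(N)` LIES IN THE CLOSED `√2·π`-WINDOW AND IN NO SMALLER ONE** (`N ≥ 2`): `U = diag(−1, −1, 1, …, 1) = expPtSU v₀` with
`‖v₀‖ = √2·π` (§1), while file 24's `exists_not_mem_expBallSU_of_lt` argument excludes it from every `expBallSU S`, `S < √2·π` (a preimage of
norm `< √2·π` would carry two real angles of modulus `≥ π`).  So file 24 §9's range is where this witness works, exactly. [folklore] -/
theorem exists_mem_expBallSU_sqrt_two_mul_pi_forall_lt_not_mem (hN : 2 ≤ N) :
    ∃ U : SUN N, U ∈ expBallSU (Real.sqrt 2 * Real.pi) ∧ ∀ S : ℝ, S < Real.sqrt 2 * Real.pi → U ∉ expBallSU S := by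
  obtain ⟨v, θ, hv, hnorm, h₀, h₁, hk⟩ := exists_chartPt_pi_neg_pi hN
  refine ⟨expPtSU v, ⟨v, mem_closedBall_zero_iff.mpr hnorm.le, rfl⟩, fun S hS hmem => ?_⟩
  -- a preimage `w` of norm `≤ S < √2·π`: `H(w)` is diagonal in the unit frame with real angles `α`, `e^{iα_k} = e^{iθ_k}`
  obtain ⟨w, hw, hwv⟩ := hmem
  have hwlt : ‖w‖ < Real.sqrt 2 * Real.pi := (mem_closedBall_zero_iff.mp hw).trans_lt hS
  have hexpw : NormedSpace.exp (genSU w) = conjDiag 1 fun k => Complex.exp (θ k * I) := by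
    rw [← exp_genSU_eq_conjDiag hv, ← coe_expPtSU, ← coe_expPtSU, hwv]
  obtain ⟨α, hα, hαθ⟩ :=
    N21ExpChartSharpRadius.exists_real_eigen_of_exp_eq_conjDiag hwlt hexpw
  -- the two angles facing `e^{±iπ} = −1` have modulus `≥ π`
  have hneg₀ : Complex.exp (α ⟨0, by omega⟩ * I) = -1 := by
    rw [hαθ, h₀, Complex.exp_pi_mul_I]
  have hneg₁ : Complex.exp (α ⟨1, by omega⟩ * I) = -1 := by
    rw [hαθ, h₁, Complex.ofReal_neg, neg_mul, Complex.exp_neg, Complex.exp_pi_mul_I, inv_neg, inv_one]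
  have hπ₀ := N21ExpChartSharpRadiusHaar.pi_le_abs_of_cexp_mul_I_eq_neg_one hneg₀
  have hπ₁ := N21ExpChartSharpRadiusHaar.pi_le_abs_of_cexp_mul_I_eq_neg_one hneg₁
  have hsq₀ : Real.pi ^ 2 ≤ α ⟨0, by omega⟩ ^ 2 := by rw [← sq_abs (α _)]; gcongr
  have hsq₁ : Real.pi ^ 2 ≤ α ⟨1, by omega⟩ ^ 2 := by rw [← sq_abs (α _)]; gcongr
  have hne : (⟨0, by omega⟩ : Fin N) ≠ ⟨1, by omega⟩ := fun h => by
    have := congrArg Fin.val h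
    simp at this
  have hsum : ∑ k, α k ^ 2 < 2 * Real.pi ^ 2 :=
    (norm_sq_eq_sum_sq hα).symm.trans_lt (N21ExpChartSharpRadius.sq_lt_two_mul_pi_sq_of_lt (norm_nonneg w) hwlt)
  have h2 := N21ExpChartSharpRadius.sq_add_sq_le_sum_sq α hne
  linarith

end Witness

end Summit.QuantumFields.YangMills.Theorems.N21ExpChartSharpRadiusBoundary

end
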